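import Literature.NumberTheory.NumberFields.RayClassFieldTwoVariableTowerDataOffset
import Literature.NumberTheory.NumberFields.RayClassFieldFrobeniusOrderGenerator
import Literature.NumberTheory.GaloisRepresentations.LocalFieldDyadicRootsOfUnity
import Literature.RingTheory.DedekindDomain.PrincipalUnitLevelResidueTwo
import Mathlib.NumberTheory.NumberField.Units.DirichletTheorem
import HarnessLib

/-!
# THE FRAME GENERATOR OF THE TWO-VARIABLE (c)-CAPSTONE TOWER AT `p = 2` WITH `α = π^f` IN `K_v` FOR A LOCAL UNIFORMISER `π` — ALWAYS,
# when the class number is ODD: take `α ≡ 1 mod 𝔤₀v̄²` (not merely `mod 𝔤₀`)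

The (c)-capstone of the `PrintCf2RubinValueTwo` Coleman lane (`…ColemanCoinvariantCharTraceEllipticUnitsTowerDataOffset*`) is framed by ONE global
element: `α ∈ 𝓞_K`, `α ≠ 0`, `α ≡ 1 mod 𝔤₀`, `(α) = 𝔭_v^f`, `α ∉ 𝔭_w (w ≠ v)`, of `v̄`-level `ℓ ≥ 1` with `α²` of exact level `ν + 1`, `f` dividing the
order of `Frob_v` on a ray class field, AND `hαπ : α = π^f` in `K_v` for the uniformiser `π` of the Lubin–Tate base `(K_v, π, f_π = πX + X²)`: by
local class field theory `K(𝔤𝔭^∞)_𝔭 = E_f·K_π^∞` (unramified of degree `f` times the Lubin–Tate tower of `π`) EXACTLY when the norm groups `⟨α⟩`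
and `⟨π^f⟩` agree (de Shalit I §1.1–1.3, II.1.10).  With `α ≡ 1 mod 𝔤₀` and `f = o(𝔤₀) := ord Frob_v(K(𝔤₀))` the element is forced,
`α = ±π₀^{o(𝔤₀)/h}` (`𝔭_v^h = (π₀)`), and `hαπ` FAILS whenever the sign is `−` and `o(𝔤₀)/h` is even (`−1 ∉ (ℚ₂^×)²`; memo BRICK-C-TRACE-g17 F11 —
a positive proportion of the conductors `𝔤₀ ⊇ 𝔣_θ` of the cm7 class).  REPAIR (this file): take the generator for the modulus `𝔤₀v̄²` instead —
`α ≡ 1 mod 𝔤₀v̄²`, `f = o(𝔤₀v̄²)`, `ν := ℓ = v̄(α − 1) ≥ 2` (then `α² − 1` has level `ℓ + 1` exactly, `2 = v̄`-uniformiser); the tower lemma needs only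
`f ∣ o(𝔤₀v̄^ν)` (`RayClassFieldTwoVariableTowerDataOffsetLevel`), which holds as `K(𝔤₀v̄²) ≤ K(𝔤₀v̄^ν)`; and NOW `α = π^f` for a local uniformiser
`π` ALWAYS, provided the class number of `K` is odd and the units of `K` have finite order (imaginary quadratic `K`): `h := ord[𝔭_v] ∣ h_K` is odd,
`𝔭_v^h = (π₀)`, `h ∣ f`, `α = ε·π₀^{f/h}` with `ε` a unit; in `K_v` (`q = 2`, `e = 1`) the roots of unity are `±1`
(`LocalFieldDyadicRootsOfUnity`), so `ε ↦ ±1`, and `π₀ ↦ ϖ^h` for a uniformiser `ϖ` (`h` odd: odd roots of units exist); if `ε ↦ −1` then `f` is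
odd — for `f` even, `π₀^{f/h}` is a square, `≡ 1 mod v̄²`, so `ε ≡ α ≡ 1 mod v̄²` and `ε = −1` would put `2 ∈ v̄²` — and `α = (−ϖ)^f`.
Everything PROVED (0 sorry, no definitions, no named facts):

* `isOfFinOrder_units_of_rank_eq_zero`, `rank_eq_zero_of_finrank_eq_two` — units of an imaginary quadratic field have finite order (Dirichlet);
* `coe_units_eq_one_or_eq_neg_one_of_isOfFinOrder` — a unit of finite order of `K` is `±1` in `K_v` (`q = 2`, `e = 1`);
* `intValuation_eq_of_span_singleton_eq_pow` (`(x) = 𝔭^n ⟹ v_𝔭(x) = exp(−n)`), `sq_sub_one_mem_sq_of_not_mem` (`x ∉ v̄`, `#𝓞/v̄ = 2`, `2 ∈ v̄ ⟹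
  x² − 1 ∈ v̄²`);
* ★★★ **`exists_frameGenerator_two`** — for `K` totally complex with units of finite order and ODD class number, `v ≠ v̄` with `2 ∈ v̄ ∖ v̄²`,
  `#𝓞/v̄ = 2`, `K_v` dyadic with `q = 2` and `2` a uniformiser, and any `𝔤₀ ≠ 0` prime to `v`, `v̄`: THERE ARE `α`, `f ≥ 1`, `ℓ ≥ 2` and a LOCAL
  UNIFORMISER `π` of `K_v` with `α ≠ 0`, `α ≡ 1 mod 𝔤₀`, `α ∉ 𝔭_w (w ≠ v)`, `(α) = 𝔭_v^f`, **`α = π^f` in `K_v`**, `v̄(α − 1) = exp(−ℓ)`,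
  `v̄(α² − 1) = exp(−(ℓ+1))`, `f ∣ ord Frob_v(K(𝔤₀v̄^ℓ))`, and `2 = π·s` (`s` a unit), `π² ∣ π − 2` (the `hu`/`hm` binders of the Coleman frame).

Cell `bsd-print-cf2`, width seat `bsd-line-cf2c-w7` g19 — F11 of the (c)-lane dissolved for every instance of the crux (`¬ 2 ∣ h_K`).

## References
* [deShalit1987] E. de Shalit, *Iwasawa theory of elliptic curves with complex multiplication* (1987), I §1.1–1.3 (relative Lubin–Tate groups,
  `k'(W_ξ) ↔ ⟨ξ⟩`), II.1.10 (p. 39), II.4.14 (p. 71), II.4.17 (p. 78).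
* [NeukirchANT1999] J. Neukirch, *Algebraic Number Theory* (1999), Ch. I §7 (Dirichlet), Ch. VI §1 Prop. (1.9), §7 Thm. (7.1), Cor. (7.3).
* [Serre1973CourseArithmetic] J.-P. Serre, *A Course in Arithmetic* (1973), Ch. II §3.1–3.3.
-/

noncomputable section

open NumberField IsDedekindDomain IsDedekindDomain.HeightOneSpectrum Field WithZero
open scoped nonZeroDivisors Classical

namespace Literature.NumberTheory.NumberFields

open Literature.NumberTheory.GaloisRepresentations
open Literature.NumberTheory.GaloisRepresentations.IsNonarchimedeanLocalField
open Literature.NumberTheory.GaloisRepresentations.ArtinLocalGlobal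
open Literature.RingTheory.DedekindDomain
open ValuativeRel

variable {K : Type} [Field K] [NumberField K] {𝔤₀ : Ideal (𝓞 K)} {v v' : HeightOneSpectrum (𝓞 K)}

/-! ### §1. Units of finite order; imaginary quadratic fields -/

omit [NumberField K] in
/-- **Units of a number field of unit rank `0` have finite order** (Dirichlet: `𝓞_K^× = μ(K) × ℤ^{rank}`). [cite: NeukirchANT1999, Ch. I §7 Thm. (7.4)] -/
theorem isOfFinOrder_units_of_rank_eq_zero [NumberField K] (h : Units.rank K = 0) (u : (𝓞 K)ˣ) : IsOfFinOrder u := by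
  obtain ⟨⟨ζ, e⟩, hu, -⟩ := Units.exist_unique_eq_mul_prod K u
  haveI : IsEmpty (Fin (Units.rank K)) := by rw [h]; infer_instance
  simp only [Finset.univ_eq_empty, Finset.prod_empty, mul_one] at hu
  rw [hu]
  exact (CommGroup.mem_torsion _).mp ζ.2

omit [NumberField K] in
/-- **An imaginary quadratic field has unit rank `0`** (`r₁ = 0`, `r₂ = 1`). [cite: NeukirchANT1999, Ch. I §7 Thm. (7.4)] -/
theorem rank_eq_zero_of_finrank_eq_two [NumberField K] [IsTotallyComplex K] (h2 : Module.finrank ℚ K = 2) : Units.rank K = 0 := by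
  have hc : InfinitePlace.nrComplexPlaces K = 1 := by
    have h := NumberField.IsTotallyComplex.finrank (K := K)
    omega
  rw [Units.rank, InfinitePlace.card_eq_nrRealPlaces_add_nrComplexPlaces, NumberField.IsTotallyComplex.nrRealPlaces_eq_zero (K := K), hc]

/-- **A unit of finite order of `K` is `±1` in `K_v`** when `K_v` is dyadic with `q = 2` and `2` a uniformiser (`e = 1`): the roots of unity of
such a field are `±1` (`LocalFieldDyadicRootsOfUnity`). [cite: Serre1973CourseArithmetic, Ch. II §3.2 Thm. 3, §3.3] -/
theorem coe_units_eq_one_or_eq_neg_one_of_isOfFinOrder (hq : residueFieldCard (v.adicCompletion K) = 2)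
    (h2 : (valuation (v.adicCompletion K)).IsUniformizer ((((2 : ℕ) : 𝒪[v.adicCompletion K]) : v.adicCompletion K)))
    {u : (𝓞 K)ˣ} (hu : IsOfFinOrder u) :
    ((((u : 𝓞 K) : K) : v.adicCompletion K)) = 1 ∨ ((((u : 𝓞 K) : K) : v.adicCompletion K)) = -1 := by
  obtain ⟨n, hn, hun⟩ := hu.exists_pow_eq_one
  have ht : (2 : 𝒪[v.adicCompletion K]) = ((2 : ℕ) : 𝒪[v.adicCompletion K]) * ((1 : 𝒪[v.adicCompletion K]ˣ) : 𝒪[v.adicCompletion K]) := by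
    rw [Units.val_one, mul_one, Nat.cast_ofNat]
  have hpow : ((((u : 𝓞 K) : K) : v.adicCompletion K)) ^ n = 1 := by
    have h1 : (((u ^ n : (𝓞 K)ˣ) : 𝓞 K) : K) = 1 := by rw [hun]; rfl
    rw [Units.val_pow_eq_pow_val] at h1
    push_cast at h1
    rw [← algebraMap_adicCompletion_apply, ← map_pow, h1, map_one]
  exact coe_eq_one_or_eq_neg_one_of_pow_eq_one h2 hq ht hn.ne' hpow

/-! ### §2. Dedekind bookkeeping -/

/-- `(x) = 𝔭^n ⟹ v_𝔭(x) = exp(−n)` (the exponential valuation of a Dedekind domain at `𝔭` reads off the exponent of `𝔭`). [cite: NeukirchANT1999, Ch. I §11 (p. 69), Ch. II §3 Prop. (3.8)] -/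
theorem intValuation_eq_of_span_singleton_eq_pow {x : 𝓞 K} {n : ℕ} (hx : Ideal.span {x} = v.asIdeal ^ n) : v.intValuation x = exp (-(n : ℤ)) := by
  refine intValuation_eq_exp_neg_of_mem_of_not_mem v ?_ ?_
  · rw [← Ideal.span_singleton_le_iff_mem, hx]
  · intro h
    rw [← Ideal.span_singleton_le_iff_mem, hx] at h
    exact (lt_iff_le_not_ge.mp (Ideal.pow_right_strictAnti _ v.ne_bot v.isPrime.ne_top (Nat.lt_succ_self n))).2 h

omit [NumberField K] in
/-- `x ∉ v̄`, `#𝓞/v̄ = 2` (so `2 ∈ v̄`) ⟹ `x² − 1 = (x − 1)(x + 1) ∈ v̄²`. [cite: Serre1973CourseArithmetic, Ch. II §3.3] -/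
theorem sq_sub_one_mem_sq_of_not_mem (h2 : Nat.card (𝓞 K ⧸ v'.asIdeal) = 2) {x : 𝓞 K} (hx : x ∉ v'.asIdeal) : x ^ 2 - 1 ∈ v'.asIdeal ^ 2 := by
  have h1 : x - 1 ∈ v'.asIdeal := mem_of_not_mem_of_card_quotient_eq_two v' h2 hx
  have h1' : x + 1 ∈ v'.asIdeal := by
    have e : x + 1 = (x - 1) + 2 := by ring
    rw [e]
    exact v'.asIdeal.add_mem h1 (two_mem_of_card_quotient_eq_two v' h2)
  rw [show x ^ 2 - 1 = (x - 1) * (x + 1) by ring, pow_two]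
  exact Ideal.mul_mem_mul h1 h1'

/-- `v ∤ 𝔤₀v'^n` for `v ∤ 𝔤₀`, `v ≠ v'`. [cite: deShalit1987, II.4.14 (p. 71)] -/
private theorem not_mul_pow_le₂₄ (hv : ¬ 𝔤₀ ≤ v.asIdeal) (hvv' : v' ≠ v) (n : ℕ) : ¬ 𝔤₀ * v'.asIdeal ^ n ≤ v.asIdeal := by
  intro h
  rcases (v.isPrime.mul_le).mp h with h1 | h2
  · exact hv h1
  · rcases n with _ | n
    · rw [pow_zero, Ideal.one_eq_top, top_le_iff] at h2
      exact v.isPrime.ne_top h2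
    · exact hvv' (HeightOneSpectrum.ext ((v'.isMaximal.eq_of_le v.isPrime.ne_top ((Ideal.IsPrime.pow_le_iff (hP := v.isPrime)
        (Nat.succ_ne_zero n)).mp h2))))

/-! ### §3. The frame generator with `α = π^f` -/

section Frame

variable [IsTotallyComplex K]
  (h𝔤0 : 𝔤₀ ≠ ⊥) (hv : ¬ 𝔤₀ ≤ v.asIdeal) (hvv' : v' ≠ v)
  (hdeg1 : Nat.card (𝓞 K ⧸ v'.asIdeal) = 2) (hpv' : (2 : 𝓞 K) ∈ v'.asIdeal) (hpv'2 : (2 : 𝓞 K) ∉ v'.asIdeal ^ 2)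
  (hcl : ¬ 2 ∣ classNumber K) (hfin : ∀ u : (𝓞 K)ˣ, IsOfFinOrder u)
  (hq : residueFieldCard (v.adicCompletion K) = 2)
  (h2 : (valuation (v.adicCompletion K)).IsUniformizer ((((2 : ℕ) : 𝒪[v.adicCompletion K]) : v.adicCompletion K)))

include h𝔤0 hv hvv' hdeg1 hpv' hpv'2 hcl hfin hq h2 in
/-- ★★★ **THE FRAME GENERATOR WITH `α = π^f` FOR A LOCAL UNIFORMISER `π`** (class number odd, units of finite order; `v ≠ v̄`, `#𝓞/v̄ = 2`,
`2 ∈ v̄ ∖ v̄²`; `K_v` with `q = 2` and `2` a uniformiser; `𝔤₀ ≠ 0` prime to `v`).  There are `α ∈ 𝓞_K`, `f ≥ 1`, `ℓ ≥ 2` and a uniformiser `π` of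
`K_v` with: `α ≠ 0`, `α − 1 ∈ 𝔤₀`, `α ∉ 𝔭_w` for `w ≠ v`, `(α) = 𝔭_v^f`, **`α = π^f` in `K_v`**, `v̄(α − 1) = exp(−ℓ)`, `v̄(α² − 1) = exp(−(ℓ+1))`,
`f ∣ ord Frob_v(K(𝔤₀v̄^ℓ)/K)`, and `2 = π·s` with `s` a unit, `π² ∣ π − 2`.  Construction: `α` = the generator `≡ 1 mod 𝔤₀v̄²` of `𝔭_v^{o(𝔤₀v̄²)}`
(Artin reciprocity), `ℓ = v̄(α−1) ≥ 2`; `𝔭_v^h = (π₀)` with `h = ord[𝔭_v]` odd, `α = επ₀^{f/h}`, `π₀ = ϖ^h` in `K_v` (odd root), `ε = ±1` in `K_v`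
(roots of unity of `K_v`), and `ε = −1` forces `f` odd (else `ε ≡ α ≡ 1 mod v̄²`, `2 ∈ v̄²`). [cite: deShalit1987, I §1.1–1.3, II.1.10 (p. 39), II.4.14 (p. 71)]
[cite: NeukirchANT1999, Ch. VI §1 Prop. (1.9), §7 Thm. (7.1)] [cite: Serre1973CourseArithmetic, Ch. II §3.3] -/
theorem exists_frameGenerator_two :
    ∃ (α : 𝓞 K) (f ℓ : ℕ) (π : 𝒪[v.adicCompletion K]),
      (valuation (v.adicCompletion K)).IsUniformizer (π : v.adicCompletion K) ∧
      α ≠ 0 ∧ α - 1 ∈ 𝔤₀ ∧ (∀ w : HeightOneSpectrum (𝓞 K), w ≠ v → α ∉ w.asIdeal) ∧ Ideal.span {α} = v.asIdeal ^ f ∧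
      ((α : K) : v.adicCompletion K) = (π : v.adicCompletion K) ^ f ∧
      1 ≤ f ∧ 2 ≤ ℓ ∧ v'.intValuation (α - 1) = exp (-(ℓ : ℤ)) ∧ v'.intValuation (α ^ 2 - 1) = exp (-((ℓ + 1 : ℕ) : ℤ)) ∧
      f ∣ orderOf (galFrob K (rayClassField K (𝔤₀ * v'.asIdeal ^ ℓ)) v) ∧
      (∃ s : 𝒪[v.adicCompletion K], IsUnit s ∧ (2 : 𝒪[v.adicCompletion K]) = π * s) ∧ π ^ 2 ∣ π - 2 := by
  -- the modulus `𝔪 = 𝔤₀v̄²` and its generator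
  have h𝔪0 : 𝔤₀ * v'.asIdeal ^ 2 ≠ ⊥ := mul_ne_zero h𝔤0 (pow_ne_zero _ v'.ne_bot)
  obtain ⟨α, hα0, hα𝔪, hαf, hαw⟩ := exists_generator_pow_orderOf_galFrob h𝔪0 (not_mul_pow_le₂₄ hv hvv' 2)
  set f := orderOf (galFrob K (rayClassField K (𝔤₀ * v'.asIdeal ^ 2)) v) with hfdef
  have hf1 : 1 ≤ f := (isOfFinOrder_of_finite _).orderOf_pos
  have hα𝔤 : α - 1 ∈ 𝔤₀ := Ideal.mul_le_right hα𝔪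
  have hα2 : α - 1 ∈ v'.asIdeal ^ 2 := Ideal.mul_le_left hα𝔪
  have hα1 : α ≠ 1 := by
    intro h
    rw [h, Ideal.span_singleton_one] at hαf
    have hlt : v.asIdeal ^ f < v.asIdeal ^ 0 := Ideal.pow_right_strictAnti _ v.ne_bot v.isPrime.ne_top hf1
    rw [pow_zero, Ideal.one_eq_top, ← hαf] at hlt
    exact lt_irrefl _ hlt
  -- the `v̄`-levels of `α − 1` (`ℓ ≥ 2`) and `α² − 1` (`ℓ + 1`)
  obtain ⟨ℓ, hℓ2, hαℓ⟩ := exists_intValuation_eq_exp_neg_of_mem_pow v' (sub_ne_zero.mpr hα1) hα2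
  have h2val : v'.intValuation (2 : 𝓞 K) = exp (-(1 : ℤ)) := by
    have h := intValuation_natCast_eq_of_mem_of_not_mem_sq v' (p := 2) (by exact_mod_cast hpv') (by exact_mod_cast hpv'2)
    exact_mod_cast h
  have hαa : v'.intValuation (α ^ 2 - 1) = exp (-((ℓ + 1 : ℕ) : ℤ)) := by
    have e : α ^ 2 - 1 = (α - 1) * ((α - 1) + 2) := by ring
    have hlt : v'.intValuation (α - 1) < v'.intValuation (2 : 𝓞 K) := by
      rw [hαℓ, h2val, exp_lt_exp]; omega
    rw [e, map_mul, Valuation.map_add_eq_of_lt_right _ hlt, hαℓ, h2val, ← exp_add]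
    congr 1; push_cast; ring
  -- `f ∣ o(𝔤₀v̄^ℓ)` since `K(𝔤₀v̄²) ≤ K(𝔤₀v̄^ℓ)`
  have hfo : f ∣ orderOf (galFrob K (rayClassField K (𝔤₀ * v'.asIdeal ^ ℓ)) v) :=
    orderOf_galFrob_dvd_of_le h𝔪0 (mul_ne_zero h𝔤0 (pow_ne_zero _ v'.ne_bot)) (not_mul_pow_le₂₄ hv hvv' 2) (not_mul_pow_le₂₄ hv hvv' ℓ)
      (rayClassField_le_of_le (mul_ne_zero h𝔤0 (pow_ne_zero _ v'.ne_bot)) (Ideal.mul_mono_right (Ideal.pow_le_pow_right hℓ2)))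
  -- `𝔭_v^h = (π₀)` with `h = ord [𝔭_v]` odd, `h ∣ f`
  have hv0 : v.asIdeal ∈ (Ideal (𝓞 K))⁰ := mem_nonZeroDivisors_iff_ne_zero.mpr v.ne_bot
  set h := orderOf (ClassGroup.mk0 ⟨v.asIdeal, hv0⟩) with hhdef
  have hhodd : Odd h := by
    refine Nat.not_even_iff_odd.mp ?_
    rw [even_iff_two_dvd]
    exact fun hd ↦ hcl (hd.trans (orderOf_dvd_card (x := ClassGroup.mk0 ⟨v.asIdeal, hv0⟩)))
  have hmk0pow : ∀ n : ℕ, ClassGroup.mk0 ⟨v.asIdeal ^ n, pow_mem hv0 n⟩ = ClassGroup.mk0 ⟨v.asIdeal, hv0⟩ ^ n := fun n ↦ by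
    rw [← map_pow]; rfl
  have hprinc : (v.asIdeal ^ h).IsPrincipal := by
    rw [← ClassGroup.mk0_eq_one_iff (pow_mem hv0 h), hmk0pow]
    exact pow_orderOf_eq_one _
  obtain ⟨π₀, hπ₀⟩ := hprinc
  have hπ₀' : Ideal.span {π₀} = v.asIdeal ^ h := hπ₀.symm
  have hhf : h ∣ f := by
    refine orderOf_dvd_of_pow_eq_one ?_
    rw [← hmk0pow, ClassGroup.mk0_eq_one_iff]
    exact ⟨⟨α, hαf.symm⟩⟩
  obtain ⟨k, hk⟩ := hhf
  -- `α = ε·π₀^k` with `ε` a unit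
  have hassoc : Associated (π₀ ^ k) α := by
    rw [← Ideal.span_singleton_eq_span_singleton, ← Ideal.span_singleton_pow, hπ₀', ← pow_mul, ← hk, hαf]
  obtain ⟨ε, hε⟩ := hassoc
  have hπ₀v' : π₀ ∉ v'.asIdeal := by
    intro hmem
    have hdvd : v'.asIdeal ∣ v.asIdeal ^ h := by rw [← hπ₀', Ideal.dvd_span_singleton]; exact hmem
    exact hvv' (HeightOneSpectrum.ext ((v.isMaximal.eq_of_le v'.isPrime.ne_top (Ideal.le_of_dvd (v'.prime.dvd_of_dvd_pow hdvd))).symm))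
  -- in `K_v`: `π₀ = c·2^h` with `c` a unit, hence `π₀ = ϖ^h` for a uniformiser `ϖ` (`h` odd)
  set F := v.adicCompletion K with hF
  have htwo : (2 : 𝒪[F]) = ((2 : ℕ) : 𝒪[F]) * ((1 : 𝒪[F]ˣ) : 𝒪[F]) := by rw [Units.val_one, mul_one, Nat.cast_ofNat]
  have h2F : ((((2 : ℕ) : 𝒪[F]) : F)) = (2 : F) := by push_cast; rfl
  have h2ne : (2 : F) ≠ 0 := by rw [← h2F]; exact h2.ne_zero
  have hvalπ₀ : Valued.v (((π₀ : K) : F)) = exp (-(h : ℤ)) := by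
    rw [valuedAdicCompletion_eq_valuation', valuation_of_algebraMap, intValuation_eq_of_span_singleton_eq_pow hπ₀']
  have hval2 : Valued.v (2 : F) = exp (-(1 : ℤ)) := by
    rw [← h2F]; exact valued_eq_exp_neg_one_of_isUniformizer (hx := h2)
  have hvalc : Valued.v (((π₀ : K) : F) / (2 : F) ^ h) = 1 := by
    rw [map_div₀, map_pow, hvalπ₀, hval2, ← exp_nsmul, div_eq_one_iff_eq (by simp)]
    congr 1; simp
  have hvalc' : valuation F (((π₀ : K) : F) / (2 : F) ^ h) = 1 :=
    ((Valuation.isEquiv_iff_val_eq_one.mp (ValuativeRel.isEquiv (Valued.v : Valuation F (WithZero (Multiplicative ℤ))) (valuation F)))).mp hvalc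
  set c : 𝒪[F] := ⟨((π₀ : K) : F) / (2 : F) ^ h, hvalc'.le⟩ with hcdef
  have hcu : IsUnit c := (Valuation.Integers.isUnit_iff_valuation_eq_one (Valuation.integer.integers (valuation F))).mpr hvalc'
  have hπ₀F : ((π₀ : K) : F) = (c : F) * ((((2 : ℕ) : 𝒪[F]) : F)) ^ h := by
    rw [h2F, hcdef]
    change _ = ((π₀ : K) : F) / (2 : F) ^ h * (2 : F) ^ h
    rw [div_mul_cancel₀ _ (pow_ne_zero _ h2ne)]
  obtain ⟨ϖ, hϖ, hϖh⟩ := exists_isUniformizer_coe_pow_eq_of_odd h2 hq htwo hhodd hcu hπ₀F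
  -- `α = ε·ϖ^f` in `K_v`, `ε = ±1`
  have hαF : ((α : K) : F) = ((((ε : (𝓞 K)ˣ) : 𝓞 K) : K) : F) * (ϖ : F) ^ f := by
    have e1 : (α : K) = (((ε : (𝓞 K)ˣ) : 𝓞 K) : K) * (π₀ : K) ^ k := by rw [← hε]; push_cast; ring
    rw [← algebraMap_adicCompletion_apply, e1, map_mul, map_pow, algebraMap_adicCompletion_apply, algebraMap_adicCompletion_apply, hk,
      pow_mul, hϖh]
  rcases coe_units_eq_one_or_eq_neg_one_of_isOfFinOrder hq h2 (hfin ε) with hε1 | hε1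
  · -- `ε = 1`: `π := ϖ`
    obtain ⟨s, hsu, hs, hdvd⟩ := exists_two_eq_mul_isUnit_and_sq_dvd_sub_two h2 hq htwo hϖ
    refine ⟨α, f, ℓ, ϖ, hϖ, hα0, hα𝔤, hαw, hαf, ?_, hf1, hℓ2, hαℓ, hαa, hfo, ⟨s, hsu, hs⟩, hdvd⟩
    rw [hαF, hε1, one_mul]
  · -- `ε = −1`: then `f` is odd and `π := −ϖ`
    have hfodd : Odd f := by
      by_contra hfeven
      rw [Nat.not_odd_iff_even] at hfeven
      have hkeven : Even k := by
        rw [hk] at hfeven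
        exact (Nat.even_mul.mp hfeven).resolve_left (Nat.not_even_iff_odd.mpr hhodd)
      obtain ⟨k', rfl⟩ := hkeven
      -- `π₀^k = (π₀^{k'})²` is `≡ 1 mod v̄²`, hence so is `ε`
      have hx : (π₀ ^ k') ^ 2 - 1 ∈ v'.asIdeal ^ 2 :=
        sq_sub_one_mem_sq_of_not_mem hdeg1 fun hm ↦ hπ₀v' (v'.isPrime.mem_of_pow_mem _ hm)
      have hε2 : ((ε : (𝓞 K)ˣ) : 𝓞 K) - 1 ∈ v'.asIdeal ^ 2 := by
        have e1 : ((ε : (𝓞 K)ˣ) : 𝓞 K) * (π₀ ^ k') ^ 2 - 1 ∈ v'.asIdeal ^ 2 := by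
          have e : ((ε : (𝓞 K)ˣ) : 𝓞 K) * (π₀ ^ k') ^ 2 = α := by rw [← hε]; ring
          rw [e]; exact hα2
        have e2 : (((ε : (𝓞 K)ˣ) : 𝓞 K) - 1) * (π₀ ^ k') ^ 2 ∈ v'.asIdeal ^ 2 := by
          have e : (((ε : (𝓞 K)ˣ) : 𝓞 K) - 1) * (π₀ ^ k') ^ 2 =
              (((ε : (𝓞 K)ˣ) : 𝓞 K) * (π₀ ^ k') ^ 2 - 1) - ((π₀ ^ k') ^ 2 - 1) := by ring
          rw [e]; exact Ideal.sub_mem _ e1 hx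
        -- `(π₀^{k'})² ∉ v̄`, so the first factor lies in `v̄²`
        have hnot : (π₀ ^ k') ^ 2 ∉ v'.asIdeal := fun hm ↦ hπ₀v' (v'.isPrime.mem_of_pow_mem _ (v'.isPrime.mem_of_pow_mem _ hm))
        rw [← intValuation_le_pow_iff_mem] at e2 ⊢
        have h1 : v'.intValuation ((π₀ ^ k') ^ 2) = 1 :=
          le_antisymm (v'.intValuation_le_one _) (not_lt.mp fun hl ↦ hnot ((intValuation_lt_one_iff_mem _ _).mp hl))
        rwa [map_mul, h1, mul_one] at e2
      -- but `ε = −1` in `K_v`, so `ε = −1` in `𝓞_K` and `−2 ∈ v̄²`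
      have hεK : (((ε : (𝓞 K)ˣ) : 𝓞 K) : K) = -1 := by
        have hinj : Function.Injective (algebraMap K F) := (algebraMap K F).injective
        apply hinj
        rw [map_neg, map_one]
        exact hε1
      have hεO : ((ε : (𝓞 K)ˣ) : 𝓞 K) = -1 := by
        apply RingOfIntegers.coe_injective
        push_cast
        exact hεK
      rw [hεO, show (-1 : 𝓞 K) - 1 = -2 by norm_num, neg_mem_iff] at hε2
      exact hpv'2 hε2
    obtain ⟨s, hsu, hs, hdvd⟩ := exists_two_eq_mul_isUnit_and_sq_dvd_sub_two h2 hq htwo (isUniformizer_neg hϖ)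
    refine ⟨α, f, ℓ, -ϖ, isUniformizer_neg hϖ, hα0, hα𝔤, hαw, hαf, ?_, hf1, hℓ2, hαℓ, hαa, hfo, ⟨s, hsu, hs⟩, hdvd⟩
    rw [hαF, hε1]
    push_cast
    rw [hfodd.neg_pow]; ring

end Frame

end Literature.NumberTheory.NumberFields

end
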